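import Mathlib
import Summits.Ventures.FusionMHD.Models.SolovevMercierAxisRegular
import Literature.MathematicalPhysics.MHD.MercierNearAxis
import HarnessLib

/-!
# Axis-regular Mercier slope/intercept on the Lee–Cerfon / PCF Solov'ev family — §7: the AXIS VALUES in closed form and
# their identification with Bateman's near-axis Mercier criterion (7.3.2)

Fourth file of the `SolovevMercierAxisRegular*` set (gridfusion-model-7 (g4), LADDER-GRIDFUSION rung F1.MERCIER, 2026-08-27);
imports only part 1 (`lcQ`, `lcDivDiff3/5`, the nine regular integrals, `N₂ = lcRegSlopeNum`, `N₀ = lcRegInterceptNum`).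
Sources: Jardin 2010 (8.134) [bib `Jardin2010`]; Lee–Cerfon 2015 §4.1 [bib `LeeCerfon2015`]; Bateman 1978 §7.3 (7.3.2) as
typed in `MercierNearAxis.lean` [bib `Bateman1978`].
* §7.1 PROVED period integrals: `∫₀^{2π} dt/(cos²t + b²sin²t) = 2π/b` (`b > 0`) by the GLOBALLY smooth primitive
  `(t + arctan((b−1)sin t cos t/(cos²t + b sin²t)))/b` (no `tan`, no branches); hence for the axis kernel
  `E = cos²t + sin²t/κ² = Q(0,t)/R₀²`: `∫dt/E = 2πκ`, `∫cos²t/E = 2πκ/(κ+1)`, `∫cos t/E = 0`.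
* §7.2–§7.3 at `r = 0`: `u ≡ R₀²`, `Q = R₀²E`, `d₃ = −3cos t/R₀⁴`, `d₅ = −5cos t/R₀⁶`; `W₁ = 2π/R₀`, `I_B = 2π/R₀³`,
  `I₆ = 2πκ/R₀³`, `I₇ = 2πκ/R₀⁵`, `I₈ = 2πκ/R₀`, `I_X = 0`, `I_Y = 8πκ/((κ+1)R₀⁵)`, `D₃ = −3π/R₀⁴`, `D₅ = −5π/(2R₀⁶)`;
  **`N₂(0) = 8π²F_B²(κ²+1)(κ²+3κ−2)/((κ+1)R₀¹⁴q₀²)`, `N₀(0) = 4π²κF_B⁴(κ²+1)²/(R₀¹⁴q₀⁴)`**, `N₂(0) > 0 ↔ κ²+3κ > 2`,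
  and the squared near-axis limit **`N₀(0)/N₂(0) = F_B²κ(κ+1)(κ²+1)/(2q₀²(κ²+3κ−2))`** (`…Limit.lean`:
  `g_M(r) → √(N₀(0)/N₂(0))` as `r → 0⁺`).
* §7.4–§7.5 **`N₀(0) < g²·N₂(0) ↔ Mercier.NearAxis.MercierCriterion q_axis(g) κ 0 0`**, `q_axis(g) = (g/F_B)q₀ =
  safetyFactorOnAxis g R₀ Ψ_RR Ψ_ZZ`, `κ = elongationOnAxis Ψ_RR Ψ_ZZ` of `Ψ = psiLC` (`Q = 0`: no poloidal current;
  `d = 0`: the family's shift parameter): AT THE MAGNETIC AXIS THE FLUX-SURFACE CRITERION (8.134) OF THE FAMILY IS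
  BATEMAN'S NEAR-AXIS MERCIER CRITERION — proved here for this family (the general «(7.3.2) is the near-axis limit of
  Mercier» is deliberately not asserted in `MercierNearAxis.lean`).  Cross-check: on the ITER-like PCF instance the closed
  form gives `0.6190279941²`, the certified axis row of `Bench/SolovevPCFIterMercierAxis`.
HONEST FRAMING: exact real analysis about MODEL objects (ideal MHD, analytic fixed-boundary Solov'ev family); Mercier is
a NECESSARY local-interchange criterion; no enclosure, no instance, no stability claim.
-/

noncomputable section

open Real Set MeasureTheory intervalIntegral Filter Topology
open Literature.MathematicalPhysics.MHD Literature.MathematicalPhysics.MHD.Solovev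
open Literature.MathematicalPhysics.MHD.GradShafranov

namespace Summit.Ventures.FusionMHD.Models

namespace LcMercierRegular

/-! ## §7.1 Three trigonometric integrals over a period -/

/-- `cos²t + b·sin²t > 0` for `b > 0`. [folklore] -/
theorem cos_sq_add_mul_sin_sq_pos {b : ℝ} (hb : 0 < b) (t : ℝ) : 0 < Real.cos t ^ 2 + b * Real.sin t ^ 2 := by
  rcases eq_or_ne (Real.sin t) 0 with hs | hs
  · have hc : Real.cos t ^ 2 = 1 := by nlinarith [Real.sin_sq_add_cos_sq t, hs]
    rw [hs, hc]; norm_num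
  · have : 0 < Real.sin t ^ 2 := by positivity
    have : 0 ≤ Real.cos t ^ 2 := sq_nonneg _
    nlinarith

/-- The globally smooth, `π`-periodic correction `h_b(t) = arctan((b−1)sin t cos t/(cos²t + b sin²t))` such that
`(t + h_b(t))/b` is a primitive of `1/(cos²t + b²sin²t)` on ALL of `ℝ` (the textbook primitive `arctan(b tan t)/b` jumps
at `π/2 + ℤπ`; `arctan(b tan t) − t = h_b(t)` on `(−π/2, π/2)`). [folklore] -/
def axisPrimitiveAux (b t : ℝ) : ℝ :=
  Real.arctan ((b - 1) * Real.sin t * Real.cos t / (Real.cos t ^ 2 + b * Real.sin t ^ 2))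

/-- `d/dt[(t + h_b(t))/b] = 1/(cos²t + b²sin²t)` for `b > 0`, every real `t`. [folklore] -/
theorem hasDerivAt_axisPrimitive {b : ℝ} (hb : 0 < b) (t : ℝ) :
    HasDerivAt (fun t => (t + axisPrimitiveAux b t) / b) (1 / (Real.cos t ^ 2 + b ^ 2 * Real.sin t ^ 2)) t := by
  have hD := cos_sq_add_mul_sin_sq_pos hb t
  have hE : 0 < Real.cos t ^ 2 + b ^ 2 * Real.sin t ^ 2 := cos_sq_add_mul_sin_sq_pos (by positivity) t
  have hN : HasDerivAt (fun t => (b - 1) * Real.sin t * Real.cos t)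
      ((b - 1) * Real.cos t * Real.cos t + (b - 1) * Real.sin t * (-Real.sin t)) t :=
    (((Real.hasDerivAt_sin t).const_mul (b - 1)).mul (Real.hasDerivAt_cos t))
  have hDd : HasDerivAt (fun y => Real.cos y ^ 2 + b * Real.sin y ^ 2)
      (((2 : ℕ) : ℝ) * Real.cos t ^ (2 - 1) * (-Real.sin t) + b * (((2 : ℕ) : ℝ) * Real.sin t ^ (2 - 1) * Real.cos t)) t :=
    ((Real.hasDerivAt_cos t).fun_pow 2).add (((Real.hasDerivAt_sin t).fun_pow 2).const_mul b)
  have hq := (hN.div hDd hD.ne').arctan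
  have hpy : Real.cos t ^ 2 + Real.sin t ^ 2 = 1 := Real.cos_sq_add_sin_sq t
  have key : HasDerivAt (fun t => (t + axisPrimitiveAux b t) / b)
      ((Real.cos t ^ 2 + Real.sin t ^ 2) / (Real.cos t ^ 2 + b ^ 2 * Real.sin t ^ 2)) t := by
    refine (((hasDerivAt_id t).add hq).div_const b).congr_deriv ?_
    have h1 : (1 : ℝ) + ((b - 1) * Real.sin t * Real.cos t / (Real.cos t ^ 2 + b * Real.sin t ^ 2)) ^ 2 ≠ 0 := by
      positivity
    have h2 := hD.ne'; have h3 := hE.ne'; have h4 := hb.ne'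
    norm_num
    field_simp
    linear_combination (Real.cos t ^ 2 * b * Real.sin t ^ 2 + Real.cos t ^ 2 * b ^ 3 * Real.sin t ^ 2
      + Real.cos t ^ 4 * b + b ^ 3 * Real.sin t ^ 4) * hpy
  rw [hpy] at key
  exact key

/-- **`∫₀^{2π} dt/(cos²t + b²sin²t) = 2π/b`** (`b > 0`). [folklore] -/
theorem integral_inv_cos_sq_add_sq_mul_sin_sq {b : ℝ} (hb : 0 < b) :
    ∫ t in (0 : ℝ)..(2 * π), 1 / (Real.cos t ^ 2 + b ^ 2 * Real.sin t ^ 2) = 2 * π / b := by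
  have hc : Continuous fun t => 1 / (Real.cos t ^ 2 + b ^ 2 * Real.sin t ^ 2) := by
    have hb2 : 0 < b ^ 2 := by positivity
    exact continuous_const.div (by fun_prop) fun t => (cos_sq_add_mul_sin_sq_pos hb2 t).ne'
  rw [intervalIntegral.integral_eq_sub_of_hasDerivAt (fun t _ => hasDerivAt_axisPrimitive hb t)
    (hc.intervalIntegrable _ _)]
  unfold axisPrimitiveAux
  simp [Real.sin_two_pi]

/-- The axis kernel `E(t) = cos²t + sin²t/κ² = Q(0,t)/R₀²` is positive (`κ ≠ 0`). [folklore] -/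
theorem axisE_pos {κ : ℝ} (hκ : κ ≠ 0) (t : ℝ) : 0 < Real.cos t ^ 2 + Real.sin t ^ 2 / κ ^ 2 := by
  have := cos_sq_add_mul_sin_sq_pos (b := 1 / κ ^ 2) (by positivity) t
  convert this using 1; ring

/-- `∫₀^{2π} dt/(cos²t + sin²t/κ²) = 2πκ` (`κ > 0`). [folklore] -/
theorem integral_inv_axisE {κ : ℝ} (hκ : 0 < κ) :
    ∫ t in (0 : ℝ)..(2 * π), 1 / (Real.cos t ^ 2 + Real.sin t ^ 2 / κ ^ 2) = 2 * π * κ := by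
  have h := integral_inv_cos_sq_add_sq_mul_sin_sq (b := 1 / κ) (by positivity)
  have e : ∀ t ∈ uIcc (0 : ℝ) (2 * π), 1 / (Real.cos t ^ 2 + Real.sin t ^ 2 / κ ^ 2)
      = 1 / (Real.cos t ^ 2 + (1 / κ) ^ 2 * Real.sin t ^ 2) := by
    intro t _; congr 1; ring
  rw [intervalIntegral.integral_congr e, h]
  field_simp

/-- `∫₀^{2π} cos²t/(cos²t + sin²t/κ²) dt = 2πκ/(κ + 1)` (`κ > 0`; for `κ ≠ 1` via
`cos²(1 − κ⁻²) = E − κ⁻²`, for `κ = 1` it is `∫cos² = π`). [folklore] -/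
theorem integral_cos_sq_div_axisE {κ : ℝ} (hκ : 0 < κ) :
    ∫ t in (0 : ℝ)..(2 * π), Real.cos t ^ 2 / (Real.cos t ^ 2 + Real.sin t ^ 2 / κ ^ 2) = 2 * π * κ / (κ + 1) := by
  have hE := axisE_pos hκ.ne'
  rcases eq_or_ne κ 1 with h1 | h1
  · subst h1
    have e : ∀ t ∈ uIcc (0 : ℝ) (2 * π), Real.cos t ^ 2 / (Real.cos t ^ 2 + Real.sin t ^ 2 / (1:ℝ) ^ 2)
        = Real.cos t ^ 2 := by
      intro t _
      rw [one_pow, div_one, Real.cos_sq_add_sin_sq, div_one]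
    rw [intervalIntegral.integral_congr e, integral_cos_sq]
    simp [Real.sin_two_pi]
    ring
  · have hκ2 : κ ^ 2 - 1 ≠ 0 := fun h => h1 (by nlinarith [hκ, h])
    have e : ∀ t ∈ uIcc (0 : ℝ) (2 * π), Real.cos t ^ 2 / (Real.cos t ^ 2 + Real.sin t ^ 2 / κ ^ 2)
        = κ ^ 2 / (κ ^ 2 - 1) * 1 + -(1 / (κ ^ 2 - 1)) * (1 / (Real.cos t ^ 2 + Real.sin t ^ 2 / κ ^ 2)) := by
      intro t _
      have hpy : Real.cos t ^ 2 + Real.sin t ^ 2 = 1 := Real.cos_sq_add_sin_sq t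
      have hs : Real.sin t ^ 2 = 1 - Real.cos t ^ 2 := by linarith
      have hEt : Real.cos t ^ 2 + (1 - Real.cos t ^ 2) / κ ^ 2 ≠ 0 := by rw [← hs]; exact (hE t).ne'
      have hEt' : Real.cos t ^ 2 * κ ^ 2 + (1 - Real.cos t ^ 2) ≠ 0 := by
        intro h; apply hEt
        have hκ0 : κ ^ 2 ≠ 0 := by positivity
        field_simp
        linarith
      have hκ0 := hκ.ne'
      rw [hs]
      field_simp
      ring
    have hc : Continuous fun t => 1 / (Real.cos t ^ 2 + Real.sin t ^ 2 / κ ^ 2) :=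
      continuous_const.div (by fun_prop) fun t => (hE t).ne'
    rw [intervalIntegral.integral_congr e, intervalIntegral.integral_add intervalIntegrable_const
      ((hc.const_mul _).intervalIntegrable _ _), intervalIntegral.integral_const_mul,
      intervalIntegral.integral_const_mul, integral_inv_axisE hκ, intervalIntegral.integral_const]
    simp only [sub_zero, smul_eq_mul, mul_one]
    have hκ1 : κ + 1 ≠ 0 := by positivity
    field_simp
    ring

/-- `∫₀^{2π} cos t/(cos²t + sin²t/κ²) dt = 0` (the integrand changes sign under `t ↦ t + π`). [folklore] -/
theorem integral_cos_div_axisE {κ : ℝ} (hκ : κ ≠ 0) :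
    ∫ t in (0 : ℝ)..(2 * π), Real.cos t / (Real.cos t ^ 2 + Real.sin t ^ 2 / κ ^ 2) = 0 := by
  have hE := axisE_pos hκ
  have hc : Continuous fun t => Real.cos t / (Real.cos t ^ 2 + Real.sin t ^ 2 / κ ^ 2) :=
    Real.continuous_cos.div (by fun_prop) fun t => (hE t).ne'
  have hsplit := intervalIntegral.integral_add_adjacent_intervals (hc.intervalIntegrable (μ := volume) 0 π)
    (hc.intervalIntegrable (μ := volume) π (2 * π))
  have hshift : ∫ t in π..(2 * π), Real.cos t / (Real.cos t ^ 2 + Real.sin t ^ 2 / κ ^ 2)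
      = -∫ t in (0 : ℝ)..π, Real.cos t / (Real.cos t ^ 2 + Real.sin t ^ 2 / κ ^ 2) := by
    have h := intervalIntegral.integral_comp_add_right (a := 0) (b := π)
      (fun t => Real.cos t / (Real.cos t ^ 2 + Real.sin t ^ 2 / κ ^ 2)) π
    rw [zero_add, ← two_mul] at h
    rw [← h, ← intervalIntegral.integral_neg]
    refine intervalIntegral.integral_congr fun t _ => ?_
    simp only [Real.cos_add_pi, Real.sin_add_pi, neg_sq, neg_div]
  rw [← hsplit, hshift, add_neg_cancel]

/-! ## §7.2 The loop at the axis: `u ≡ R₀²`, `Q(0,t) = R₀²(cos²t + sin²t/κ²)`, `d₃(0,t) = −3cos t/R₀⁴`, `d₅(0,t) = −5cos t/R₀⁶` -/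

section axis

variable {κ FB R₀ q₀ : ℝ} (hR₀ : 0 < R₀) (hκ : 0 < κ) (hFB : 0 < FB) (hq₀ : 0 < q₀)

/-- `u(0,t) = R₀²`. [cite: LeeCerfon2015, §4.1 (boundary parametrisation)] -/
theorem lcU_axis (R₀ t : ℝ) : lcU R₀ 0 t = R₀ ^ 2 := by unfold lcU; ring
include hR₀ in
/-- `√u(0,t) = R₀`. [cite: LeeCerfon2015, §4.1 (boundary parametrisation)] -/
theorem sqrt_lcU_axis (t : ℝ) : Real.sqrt (lcU R₀ 0 t) = R₀ := by rw [lcU_axis, Real.sqrt_sq hR₀.le]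
include hR₀ hκ in
/-- `Q(0,t) = R₀²·(cos²t + sin²t/κ²)`. [cite: LeeCerfon2015, §4.1 (boundary parametrisation)] -/
theorem lcQ_axis (t : ℝ) : lcQ κ R₀ 0 t = R₀ ^ 2 * (Real.cos t ^ 2 + Real.sin t ^ 2 / κ ^ 2) := by
  have hR := hR₀.ne'; have hk := hκ.ne'
  unfold lcQ; rw [lcU_axis]; field_simp; ring
include hR₀ in
/-- `d₃(0,t) = −3cos t/R₀⁴`. [folklore] -/
theorem lcDivDiff3_axis (t : ℝ) : lcDivDiff3 R₀ 0 t = -(3 * Real.cos t) / R₀ ^ 4 := by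
  have hR := hR₀.ne'
  unfold lcDivDiff3; rw [sqrt_lcU_axis hR₀, lcU_axis]; field_simp; ring
include hR₀ in
/-- `d₅(0,t) = −5cos t/R₀⁶`. [folklore] -/
theorem lcDivDiff5_axis (t : ℝ) : lcDivDiff5 R₀ 0 t = -(5 * Real.cos t) / R₀ ^ 6 := by
  have hR := hR₀.ne'
  unfold lcDivDiff5; rw [sqrt_lcU_axis hR₀, lcU_axis]; field_simp; ring

/-! ## §7.3 The nine regular integrals AT the axis in closed form -/
include hR₀ in
/-- `W₁(0) = 2π/R₀`, `I_B(0) = 2π/R₀³`. [cite: Jardin2010, §5.3 eq. (5.29)] -/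
theorem lcRegI0_axis : lcRegI0 R₀ 0 = 2 * π / R₀ ∧ lcRegIB R₀ 0 = 2 * π / R₀ ^ 3 := by
  have hR := hR₀.ne'
  constructor
  · unfold lcRegI0
    rw [intervalIntegral.integral_congr (g := fun _ => R₀⁻¹) fun t _ => by simp only [sqrt_lcU_axis hR₀],
      intervalIntegral.integral_const]
    simp only [sub_zero, smul_eq_mul]; field_simp
  · unfold lcRegIB
    rw [intervalIntegral.integral_congr (g := fun _ => (R₀ ^ 3)⁻¹) fun t _ => by
        rw [sqrt_lcU_axis hR₀, lcU_axis]; ring,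
      intervalIntegral.integral_const]
    simp only [sub_zero, smul_eq_mul]; field_simp
include hR₀ hκ in
/-- `I₆(0) = 2πκ/R₀³`, `I₇(0) = 2πκ/R₀⁵`, `I₈(0) = 2πκ/R₀` (from `∫₀^{2π} dt/(cos²t + sin²t/κ²) = 2πκ`).
[cite: Jardin2010, §5.3 eq. (5.30)] -/
theorem lcRegI678_axis :
    lcRegI6 κ R₀ 0 = 2 * π * κ / R₀ ^ 3 ∧ lcRegI7 κ R₀ 0 = 2 * π * κ / R₀ ^ 5 ∧ lcRegI8 κ R₀ 0 = 2 * π * κ / R₀ := by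
  have hR := hR₀.ne'; have hk := hκ.ne'
  have hE := axisE_pos hκ.ne'
  have hL := integral_inv_axisE hκ
  refine ⟨?_, ?_, ?_⟩
  · unfold lcRegI6
    rw [intervalIntegral.integral_congr (g := fun t => (R₀ ^ 3)⁻¹ * (1 / (Real.cos t ^ 2 + Real.sin t ^ 2 / κ ^ 2)))
        fun t _ => by
          have hEt := (hE t).ne'
          rw [sqrt_lcU_axis hR₀, lcQ_axis hR₀ hκ]; field_simp,
      intervalIntegral.integral_const_mul, hL]
    field_simp
  · unfold lcRegI7
    rw [intervalIntegral.integral_congr (g := fun t => (R₀ ^ 5)⁻¹ * (1 / (Real.cos t ^ 2 + Real.sin t ^ 2 / κ ^ 2)))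
        fun t _ => by
          have hEt := (hE t).ne'
          rw [sqrt_lcU_axis hR₀, lcU_axis, lcQ_axis hR₀ hκ]; field_simp,
      intervalIntegral.integral_const_mul, hL]
    field_simp
  · unfold lcRegI8
    rw [intervalIntegral.integral_congr (g := fun t => R₀⁻¹ * (1 / (Real.cos t ^ 2 + Real.sin t ^ 2 / κ ^ 2)))
        fun t _ => by
          have hEt := (hE t).ne'
          rw [sqrt_lcU_axis hR₀, lcQ_axis hR₀ hκ]; field_simp,
      intervalIntegral.integral_const_mul, hL]
    field_simp
include hR₀ hκ in
/-- `I_X(0) = 0` (antisymmetry under `t ↦ t + π`) and `I_Y(0) = 8πκ/((κ+1)R₀⁵)` (from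
`∫₀^{2π} cos²t/(cos²t + sin²t/κ²) = 2πκ/(κ+1)`). [cite: Jardin2010, §8.5.4 eq. (8.134)] -/
theorem lcRegIXY_axis : lcRegIX κ R₀ 0 = 0 ∧ lcRegIY κ R₀ 0 = 8 * π * κ / ((κ + 1) * R₀ ^ 5) := by
  have hR := hR₀.ne'; have hk := hκ.ne'
  have hE := axisE_pos hκ.ne'
  constructor
  · unfold lcRegIX
    rw [intervalIntegral.integral_congr (g := fun t => 2 / R₀ ^ 4 * (Real.cos t / (Real.cos t ^ 2 + Real.sin t ^ 2 / κ ^ 2)))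
        fun t _ => by
          have hEt := (hE t).ne'
          rw [sqrt_lcU_axis hR₀, lcQ_axis hR₀ hκ]; field_simp,
      intervalIntegral.integral_const_mul, integral_cos_div_axisE hκ.ne', mul_zero]
  · unfold lcRegIY
    rw [intervalIntegral.integral_congr (g := fun t => 4 / R₀ ^ 5
          * (Real.cos t ^ 2 / (Real.cos t ^ 2 + Real.sin t ^ 2 / κ ^ 2))) fun t _ => by
          have hEt := (hE t).ne'
          rw [sqrt_lcU_axis hR₀, lcU_axis, lcQ_axis hR₀ hκ]; field_simp,
      intervalIntegral.integral_const_mul, integral_cos_sq_div_axisE hκ]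
    have : κ + 1 ≠ 0 := by positivity
    field_simp
    ring
include hR₀ in
/-- `D₃(0) = −3π/R₀⁴` and `D₅(0) = −5π/(2R₀⁶)` (`∫₀^{2π}cos² = π`, `∫₀^π cos² = π/2`). [cite: Jardin2010, §8.5.4 eq. (8.134)] -/
theorem lcRegD35_axis : lcRegD3 R₀ 0 = -(3 * π) / R₀ ^ 4 ∧ lcRegD5 R₀ 0 = -(5 * π) / (2 * R₀ ^ 6) := by
  have hR := hR₀.ne'
  constructor
  · unfold lcRegD3
    rw [intervalIntegral.integral_congr (g := fun t => -3 / R₀ ^ 4 * Real.cos t ^ 2) fun t _ => by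
          simp only [lcDivDiff3_axis hR₀]; ring,
      intervalIntegral.integral_const_mul, integral_cos_sq]
    simp [Real.sin_two_pi]; ring
  · unfold lcRegD5
    rw [intervalIntegral.integral_congr (g := fun t => -5 / R₀ ^ 6 * Real.cos t ^ 2) fun t _ => by
          simp only [lcDivDiff5_axis hR₀]; ring,
      intervalIntegral.integral_const_mul, integral_cos_sq]
    simp; ring
include hR₀ hκ hFB hq₀ in
/-- **THE AXIS VALUES OF THE REGULAR NUMERATORS IN CLOSED FORM:**
`N₂(0) = 8π²F_B²(κ²+1)(κ²+3κ−2)/((κ+1)R₀¹⁴q₀²)` and `N₀(0) = 4π²κF_B⁴(κ²+1)²/(R₀¹⁴q₀⁴)`.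
[cite: Jardin2010, §8.5.4 eq. (8.134)] -/
theorem lcRegNum_axis :
    lcRegSlopeNum κ FB R₀ q₀ 0 = 8 * π ^ 2 * FB ^ 2 * (κ ^ 2 + 1) * (κ ^ 2 + 3 * κ - 2) / ((κ + 1) * R₀ ^ 14 * q₀ ^ 2)
    ∧ lcRegInterceptNum κ FB R₀ q₀ 0 = 4 * π ^ 2 * κ * FB ^ 4 * (κ ^ 2 + 1) ^ 2 / (R₀ ^ 14 * q₀ ^ 4) := by
  have hR := hR₀.ne'; have hk := hκ.ne'; have hF := hFB.ne'; have hq := hq₀.ne'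
  obtain ⟨h0, hB⟩ := lcRegI0_axis hR₀
  obtain ⟨h6, h7, h8⟩ := lcRegI678_axis hR₀ hκ
  obtain ⟨hX, hY⟩ := lcRegIXY_axis hR₀ hκ
  obtain ⟨h3, h5⟩ := lcRegD35_axis hR₀
  have hk1 : κ + 1 ≠ 0 := by positivity
  constructor
  · unfold lcRegSlopeNum csLC
    rw [h6, h7, h8, hX, hY, h3, h5]
    field_simp
    ring
  · unfold lcRegInterceptNum csLC
    rw [hB, h8, h3]
    field_simp
    ring
include hR₀ hκ hFB hq₀ in
/-- `N₂(0) > 0 ↔ κ² + 3κ > 2` (i.e. `κ > (√17 − 3)/2 ≈ 0.56`): the near-axis surfaces are Mercier-stabilisable by a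
toroidal field exactly for these elongations; in particular the limit theorem `tendsto_lcMercierThreshold_axis`
applies whenever `κ² + 3κ ≠ 2`. [cite: Jardin2010, §8.5.4 eq. (8.134)] -/
theorem lcRegSlopeNum_axis_pos_iff : 0 < lcRegSlopeNum κ FB R₀ q₀ 0 ↔ 2 < κ ^ 2 + 3 * κ := by
  rw [(lcRegNum_axis hR₀ hκ hFB hq₀).1]
  have hC : 0 < 8 * π ^ 2 * FB ^ 2 * (κ ^ 2 + 1) / ((κ + 1) * R₀ ^ 14 * q₀ ^ 2) := by positivity
  have e : 8 * π ^ 2 * FB ^ 2 * (κ ^ 2 + 1) * (κ ^ 2 + 3 * κ - 2) / ((κ + 1) * R₀ ^ 14 * q₀ ^ 2)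
      = 8 * π ^ 2 * FB ^ 2 * (κ ^ 2 + 1) / ((κ + 1) * R₀ ^ 14 * q₀ ^ 2) * (κ ^ 2 + 3 * κ - 2) := by ring
  rw [e, mul_pos_iff_of_pos_left hC, sub_pos]
include hR₀ hκ hFB hq₀ in
/-- **The square of the near-axis limit of the flux-surface threshold in closed form:**
`N₀(0)/N₂(0) = F_B²κ(κ+1)(κ²+1)/(2q₀²(κ²+3κ−2))` (for `κ² + 3κ = 2` both sides are the junk value `0`).
On the ITER-like PCF instance (LC parameters `κ₀² = 2257675225/758468676`, `q₀²/F² = r_q`) this is `0.38319566`,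
square root `0.61902799` = the certified Bateman axis row. [cite: Jardin2010, §8.5.4 eq. (8.134)] -/
theorem lcRegRatio_axis :
    lcRegInterceptNum κ FB R₀ q₀ 0 / lcRegSlopeNum κ FB R₀ q₀ 0
      = FB ^ 2 * κ * (κ + 1) * (κ ^ 2 + 1) / (2 * q₀ ^ 2 * (κ ^ 2 + 3 * κ - 2)) := by
  obtain ⟨h2, h0⟩ := lcRegNum_axis hR₀ hκ hFB hq₀
  rw [h2, h0]
  have hR := hR₀.ne'; have hk := hκ.ne'; have hF := hFB.ne'; have hq := hq₀.ne'; have hπ := Real.pi_pos.ne'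
  have hk1 : κ + 1 ≠ 0 := by positivity
  rcases eq_or_ne (κ ^ 2 + 3 * κ - 2) 0 with hz | hz
  · rw [hz]; simp
  · field_simp
    ring

/-! ## §7.4 Identification with Bateman's near-axis Mercier criterion (7.3.2) (`Q = 0`, `d = 0`) -/
include hR₀ hκ hFB hq₀ in
/-- **THE AXIS INEQUALITY IS BATEMAN'S NEAR-AXIS MERCIER CRITERION.** For every free constant `g ≠ 0`:
`N₀(0) < g²·N₂(0) ↔ Mercier.NearAxis.MercierCriterion (g·q₀/F_B) κ 0 0`, i.e.
`1/q_axis² < 6/(1+κ²) − 4/(κ(κ+1))` with `q_axis = (g/F_B)·q₀` the on-axis safety factor of the model field with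
toroidal constant `g`, elongation `e = κ`, no poloidal current (`Q = 0`, `FF′ = 0`) and `d = 0` (the family's
near-axis shift parameter, `nearAxisD = 0` on the PCF instances).  Both sides are `0 < 2g²q₀²(κ²+3κ−2) −
F_B²κ(κ+1)(κ²+1)` up to positive factors.  With `tendsto_lcMercierThreshold_axis` (`…Limit.lean`): the FLUX-SURFACE
Mercier criterion (Jardin (8.134)) on the surfaces `r → 0⁺` of the Lee–Cerfon / PCF Solov'ev family converges to the
NEAR-AXIS criterion (Bateman (7.3.2), Mercier necessary form) — proved, for this family, not assumed.
[cite: Bateman1978, §7.3 eq. (7.3.2)] -/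
theorem regular_axis_iff_nearAxis {g : ℝ} (hg : g ≠ 0) :
    lcRegInterceptNum κ FB R₀ q₀ 0 < g ^ 2 * lcRegSlopeNum κ FB R₀ q₀ 0
      ↔ Mercier.NearAxis.MercierCriterion (g * q₀ / FB) κ 0 0 := by
  obtain ⟨h2, h0⟩ := lcRegNum_axis hR₀ hκ hFB hq₀
  have hR := hR₀.ne'; have hk := hκ.ne'; have hF := hFB.ne'; have hq := hq₀.ne'; have hπ := Real.pi_pos
  have hk1 : 0 < κ + 1 := by positivity
  set P : ℝ := 2 * g ^ 2 * q₀ ^ 2 * (κ ^ 2 + 3 * κ - 2) - FB ^ 2 * κ * (κ + 1) * (κ ^ 2 + 1) with hP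
  have hCL : 0 < 4 * π ^ 2 * FB ^ 2 * (κ ^ 2 + 1) / ((κ + 1) * R₀ ^ 14 * q₀ ^ 4) := by positivity
  have eL : g ^ 2 * lcRegSlopeNum κ FB R₀ q₀ 0 - lcRegInterceptNum κ FB R₀ q₀ 0
      = 4 * π ^ 2 * FB ^ 2 * (κ ^ 2 + 1) / ((κ + 1) * R₀ ^ 14 * q₀ ^ 4) * P := by
    rw [h2, h0, hP]; field_simp; ring
  have hCR : 0 < 1 / ((1 + κ ^ 2) * κ * (κ + 1) * g ^ 2 * q₀ ^ 2) := by positivity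
  have eR : Mercier.NearAxis.bound κ 0 0 1 - 1 / (g * q₀ / FB) ^ 2
      = 1 / ((1 + κ ^ 2) * κ * (κ + 1) * g ^ 2 * q₀ ^ 2) * P := by
    unfold Mercier.NearAxis.bound; rw [hP]; field_simp; ring
  have hL : lcRegInterceptNum κ FB R₀ q₀ 0 < g ^ 2 * lcRegSlopeNum κ FB R₀ q₀ 0 ↔ 0 < P := by
    rw [← sub_pos, eL, mul_pos_iff_of_pos_left hCL]
  have hRt : Mercier.NearAxis.MercierCriterion (g * q₀ / FB) κ 0 0 ↔ 0 < P := by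
    unfold Mercier.NearAxis.MercierCriterion
    rw [← sub_pos, eR, mul_pos_iff_of_pos_left hCR]
  exact hL.trans hRt.symm

/-! ## §7.5 In the model's own axis vocabulary (`safetyFactorOnAxis`, `elongationOnAxis` of `Ψ = psiLC`) -/
include hR₀ hκ hFB hq₀ in
/-- For `Ψ = psiLC κ F_B R₀ q₀ a` and a field with toroidal constant `g`: the on-axis safety factor (Freidberg (6.42),
`safetyFactorOnAxis`) is `(g/F_B)·q₀` and the on-axis elongation is `κ`. [cite: LeeCerfon2015, §4.1] -/
theorem axisData_lc (a g : ℝ) :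
    safetyFactorOnAxis g R₀ (dRR (psiLC κ FB R₀ q₀ a) R₀ 0) (dZZ (psiLC κ FB R₀ q₀ a) R₀ 0) = g * q₀ / FB
    ∧ elongationOnAxis (dRR (psiLC κ FB R₀ q₀ a) R₀ 0) (dZZ (psiLC κ FB R₀ q₀ a) R₀ 0) = κ := by
  obtain ⟨hq, hr⟩ := safetyFactorOnAxis_LC (κ := κ) (FB := FB) (R₀ := R₀) (q₀ := q₀) a hFB hR₀ hκ hq₀
  constructor
  · unfold safetyFactorOnAxis at hq ⊢
    have hden : R₀ * Real.sqrt (dRR (psiLC κ FB R₀ q₀ a) R₀ 0 * dZZ (psiLC κ FB R₀ q₀ a) R₀ 0) ≠ 0 := by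
      intro h; rw [h, div_zero] at hq; exact hq₀.ne' hq.symm
    rw [div_eq_iff hden] at hq
    rw [div_eq_div_iff hden hFB.ne']
    linear_combination g * hq
  · unfold elongationOnAxis
    rw [hr, Real.sqrt_sq hκ.le]
include hR₀ hκ hFB hq₀ in
/-- **HEADLINE (model vocabulary).** For the Lee–Cerfon / PCF Solov'ev flux function `Ψ = psiLC κ F_B R₀ q₀ a` and every
toroidal constant `g > 0`: the axis value of the regular Mercier inequality holds iff Bateman's near-axis Mercier
criterion holds for the model's own on-axis safety factor and elongation (`Q = 0`, `d = 0`):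
`N₀(0) < g²·N₂(0) ↔ MercierCriterion q_axis(g) e_axis 0 0`. [cite: Bateman1978, §7.3 eq. (7.3.2)] -/
theorem regular_axis_iff_mercierNearAxis (a : ℝ) {g : ℝ} (hg : 0 < g) :
    lcRegInterceptNum κ FB R₀ q₀ 0 < g ^ 2 * lcRegSlopeNum κ FB R₀ q₀ 0
      ↔ Mercier.NearAxis.MercierCriterion
          (safetyFactorOnAxis g R₀ (dRR (psiLC κ FB R₀ q₀ a) R₀ 0) (dZZ (psiLC κ FB R₀ q₀ a) R₀ 0))
          (elongationOnAxis (dRR (psiLC κ FB R₀ q₀ a) R₀ 0) (dZZ (psiLC κ FB R₀ q₀ a) R₀ 0)) 0 0 := by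
  obtain ⟨hq, he⟩ := axisData_lc hR₀ hκ hFB hq₀ a g
  rw [hq, he]
  exact regular_axis_iff_nearAxis hR₀ hκ hFB hq₀ hg.ne'

end axis

end LcMercierRegular

end Summit.Ventures.FusionMHD.Models

end
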